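import Summits.NavierStokesRegularity.NavierStokesRegularity.Theorems.EulerZoomLiouvillePowerGaugeEulerLiouvilleWeakHighSetFlux
import Summits.NavierStokesRegularity.NavierStokesRegularity.Theorems.EulerZoomLiouvillePowerGaugeEulerLiouvilleWeakFastSetThin

/-!
# «JETS MUST TURN» in the weak class, unconditional form on FAST high sets: a far high set made of fast points is Sobolev-thin, so the
# turning law holds on every far layer with the explicit deficit `3γ·K·(R(R−r))^{−(3+3ρ)/2}`
# (crux `EulerZoomLiouville.PowerGaugeEulerLiouville` = stmt-NavierStokesRegularity-19832, line `birth`, open stub `stub_selfSimilarWeakRest`)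

Width seat `ns-ezl-w1` (g7) under the crux LEAD.  Sequel of `…WeakHighSetFlux` (`highSet_flux_turning_law`, which asks the far high set
`{ℋ > h} ∩ {R(R−r) ≤ |x|²}` to have finite volume) and of g6's weak fast-set thinness `WeakThin.volume_fastSet_inter_far_le`
(`vol({a|y| ≤ |V|} ∩ {R ≤ |y|}) ≤ K R^{−3−3ρ}`, NO regularity).

* `WeakRenormalized.norm_ge_of_inner_transport_le` — an INFLOW point of rate `c₁` is FAST: `⟪y, W y⟫ ≤ −c₁|y|²` ⇒ `(γ + c₁)|y| ≤ |V y|`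
  (the channel hypotheses of the `C²` lattice, `HasFastVorticalChannel`, put the far vortical high points in the fast set);
* **`WeakRenormalized.volume_highSet_inter_far_le_of_fast`** — if a.e. far point of the high set `{ℋ > h}` is fast (`a|y| ≤ |V y|` for
  `|y| ≥ R₀`), then `vol({ℋ > h} ∩ {R ≤ |y|}) ≤ K R^{−3−3ρ}` for `R ≥ max L₀ R₀` (weak class: `V` with whole-space weak gradient and the
  large-scale `A`/`E` growth);
* **`WeakRenormalized.highSet_flux_turning_law_of_fast`** — hence, for such a level, the turning law on EVERY far layer with the explicit
  Sobolev deficit: `∫_{ℋ>h} −Dθ_{R,r}[W] ≥ −3γ·K·(R(R−r))^{−(3+3ρ)/2}` (`R(R−r) ≥ (max L₀ R₀)²`);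
* member level `…_of_past` / `…_of_selfSimilar` (crux hypotheses verbatim, `0 < ρ ≤ ½`).

HONEST LABEL: weak-class bookkeeping tools; nothing here excludes a profile.  WHAT THIS IS NOT: not NS, not E — `--supports` stmt-19832;
19832 OPEN; NS regularity NOT proved. [folklore; ConstantinIgnatovaVicol2026Putative §3.4.1 (3.22), §3.4.3 (3.33)]
-/

noncomputable section

set_option linter.dupNamespace false
-- nested operator types (`innerSL … ∘L …`)
set_option maxSynthPendingDepth 3

open MeasureTheory Set Filter Topology Metric Function TopologicalSpace
open scoped ENNReal NNReal RealInnerProductSpace ContDiff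

namespace Summit.NavierStokesRegularity.NavierStokesRegularity.Theorems.PowerGaugeEulerLiouville

open Literature.Analysis Literature.Analysis.FunctionSpaces Literature.Analysis.FluidPDE

namespace WeakRenormalized

variable {V : EuclideanSpace ℝ (Fin 3) → EuclideanSpace ℝ (Fin 3)} {P : EuclideanSpace ℝ (Fin 3) → ℝ}
  {G : EuclideanSpace ℝ (Fin 3) → EuclideanSpace ℝ (Fin 3) →L[ℝ] EuclideanSpace ℝ (Fin 3)}

/-! ## Inflow points are fast -/

/-- **An inflow point of rate `c₁` is fast**: `⟪y, W y⟫ ≤ −c₁‖y‖²` (`W = γy + V`) ⇒ `(γ + c₁)‖y‖ ≤ ‖V y‖`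
(`⟪y, W y⟫ = γ‖y‖² + ⟪y, V y⟫` and Cauchy–Schwarz). [folklore] -/
theorem norm_ge_of_inner_transport_le {γ c₁ : ℝ} {y : EuclideanSpace ℝ (Fin 3)}
    (hy : ⟪y, selfSimilarTransport γ 0 V y⟫ ≤ -c₁ * ‖y‖ ^ 2) : (γ + c₁) * ‖y‖ ≤ ‖V y‖ := by
  have e : ⟪y, selfSimilarTransport γ 0 V y⟫ = γ * ‖y‖ ^ 2 + ⟪y, V y⟫ := by
    rw [selfSimilarTransport_apply, sub_zero, inner_add_right, real_inner_smul_right, real_inner_self_eq_norm_sq]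
  rw [e] at hy
  have hcs : -(‖y‖ * ‖V y‖) ≤ ⟪y, V y⟫ := by
    have := abs_real_inner_le_norm y (V y)
    rw [abs_le] at this; exact this.1
  have h1 : (γ + c₁) * ‖y‖ ^ 2 ≤ ‖y‖ * ‖V y‖ := by nlinarith
  rcases (norm_nonneg y).eq_or_lt with h0 | hpos
  · rw [← h0, mul_zero]; exact norm_nonneg _
  · have h2 : (γ + c₁) * ‖y‖ * ‖y‖ ≤ ‖V y‖ * ‖y‖ := by nlinarith
    exact le_of_mul_le_mul_right h2 hpos

/-! ## Fast high sets are thin far out -/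

section Far

/-- **A FAR HIGH SET MADE OF FAST POINTS IS SOBOLEV-THIN (weak class).**  `V` a.e.-strongly measurable with whole-space weak gradient `G` and the
large-scale growth `∫_{B_L}‖V‖² ≤ c_A L^{1−2ρ}`, `∫_{B_L}|G|²_F ≤ c_E L^{1−ρ}` for `L ≥ L₀ ≥ 1` (`ρ > −1`); `ℋ` any function; if a.e. point `y` with
`‖y‖ ≥ R₀` and `ℋ y > h` is fast, `a‖y‖ ≤ ‖V y‖` (`a > 0`), then there is `K ≥ 0` with `vol({ℋ > h} ∩ {R ≤ ‖y‖}) ≤ K R^{−3−3ρ}` for all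
`R ≥ max L₀ R₀` (`WeakThin.volume_fastSet_inter_far_le`). [folklore] -/
theorem volume_highSet_inter_far_le_of_fast {ρ : ℝ} (hρ : -1 < ρ) (hVm : AEStronglyMeasurable V volume)
    (hVG : HasWeakFDerivOn (⊤ : Opens (EuclideanSpace ℝ (Fin 3))) volume V G)
    {cA cE L₀ : ℝ} (hcA : 0 ≤ cA) (hcE : 0 ≤ cE) (hL₀ : 1 ≤ L₀)
    (hA : ∀ L : ℝ, L₀ ≤ L → ∫⁻ y in ball (0 : EuclideanSpace ℝ (Fin 3)) L, ‖V y‖ₑ ^ 2 ≤ ENNReal.ofReal (cA * L ^ (1 - 2 * ρ)))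
    (hE : ∀ L : ℝ, L₀ ≤ L → ∫⁻ y in ball (0 : EuclideanSpace ℝ (Fin 3)) L, ENNReal.ofReal (frobeniusNormSq (G y)) ≤
      ENNReal.ofReal (cE * L ^ (1 - ρ)))
    {Hb : EuclideanSpace ℝ (Fin 3) → ℝ} {h a R₀ : ℝ} (ha : 0 < a)
    (hfast : ∀ᵐ y ∂(volume : Measure (EuclideanSpace ℝ (Fin 3))), R₀ ≤ ‖y‖ → h < Hb y → a * ‖y‖ ≤ ‖V y‖) :
    ∃ K : ℝ, 0 ≤ K ∧ ∀ R : ℝ, max L₀ R₀ ≤ R →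
      volume ({y | h < Hb y} ∩ {y : EuclideanSpace ℝ (Fin 3) | R ≤ ‖y‖}) ≤ ENNReal.ofReal (K * R ^ (-3 - 3 * ρ)) := by
  obtain ⟨K, hK0, hK⟩ := WeakThin.volume_fastSet_inter_far_le hρ hVm hVG hcA hcE hL₀ hA hE ha
  refine ⟨K, hK0, fun R hR => ?_⟩
  have hRL : L₀ ≤ R := le_trans (le_max_left _ _) hR
  have hRR₀ : R₀ ≤ R := le_trans (le_max_right _ _) hR
  have hsub : (({y | h < Hb y} ∩ {y : EuclideanSpace ℝ (Fin 3) | R ≤ ‖y‖} : Set (EuclideanSpace ℝ (Fin 3)))) ≤ᵐ[volume]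
      (({y : EuclideanSpace ℝ (Fin 3) | a * ‖y‖ ≤ ‖V y‖} ∩ {y | R ≤ ‖y‖} : Set (EuclideanSpace ℝ (Fin 3)))) := by
    filter_upwards [hfast] with y hy hmem
    exact ⟨hy (hRR₀.trans hmem.2) hmem.1, hmem.2⟩
  exact (measure_mono_ae hsub).trans (hK R hRL)

/-- The far layer lies beyond radius `√(R(R−r))`: `{R(R−r) ≤ ‖x‖²} ⊆ {√(R(R−r)) ≤ ‖x‖}`. [folklore] -/
theorem far_subset_sqrt {R r : ℝ} :
    {x : EuclideanSpace ℝ (Fin 3) | R * (R - r) ≤ ‖x‖ ^ 2} ⊆ {x | Real.sqrt (R * (R - r)) ≤ ‖x‖} := fun x hx => by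
  have h : Real.sqrt (R * (R - r)) ≤ Real.sqrt (‖x‖ ^ 2) := Real.sqrt_le_sqrt hx
  rwa [Real.sqrt_sq (norm_nonneg _)] at h

/-- **THE TURNING LAW ON EVERY FAR LAYER FOR A FAST HIGH SET (weak class, explicit Sobolev deficit).**  Under the hypotheses of
`highSet_flux_turning_law` (`0 ≤ γ ≤ ½`, weak class profile with the Lamb form, `A`-growth `∫_{B_L}‖V‖² ≤ c_A L`) and with a thinness bound
`vol({ℋ > h} ∩ {ϱ ≤ ‖y‖}) ≤ K ϱ^{s}` for `ϱ ≥ ϱ₀ > 0` (any real `s`; `s = −3−3ρ` from `volume_highSet_inter_far_le_of_fast`, `s = −1−2ρ` for every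
high set of a class profile, `…WeakHighSetThin`), every layer `0 < r ≤ R` with `ϱ₀² ≤ R(R−r)` satisfies
`−3γ·K·(R(R−r))^{s/2} ≤ ∫_{ℋ>h} −Dθ_{R,r}[W]`. [folklore] -/
theorem highSet_flux_turning_law_of_thin {γ s : ℝ} (hγ0 : 0 ≤ γ) (hγ : γ ≤ 1 / 2)
    (hV6 : ∀ r : ℝ, MemLp V 6 (volume.restrict (ball (0 : EuclideanSpace ℝ (Fin 3)) r)))
    (hG2 : ∀ r : ℝ, MemLp G 2 (volume.restrict (ball (0 : EuclideanSpace ℝ (Fin 3)) r)))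
    (hP32 : ∀ r : ℝ, MemLp P (3 / 2 : ℝ≥0∞) (volume.restrict (ball (0 : EuclideanSpace ℝ (Fin 3)) r)))
    (hdiv : IsWeaklyDivFree V)
    (hH : HasWeakFDerivOn (⊤ : Opens (EuclideanSpace ℝ (Fin 3))) volume (selfSimilarBernoulli γ 0 V P)
      (fun x => (2 * γ - 1) • innerSL ℝ (selfSimilarTransport γ 0 V x) +
        (innerSL ℝ (selfSimilarTransport γ 0 V x)).comp (G x) - innerSL ℝ (G x (selfSimilarTransport γ 0 V x))))
    {cA L₀ : ℝ} (hA : ∀ L : ℝ, L₀ ≤ L → ∫ x in ball (0 : EuclideanSpace ℝ (Fin 3)) L, ‖V x‖ ^ 2 ≤ cA * L)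
    {h K ϱ₀ : ℝ} (hK0 : 0 ≤ K) (hϱ₀ : 0 < ϱ₀)
    (hthin : ∀ ϱ : ℝ, ϱ₀ ≤ ϱ → volume ({y | h < selfSimilarBernoulli γ 0 V P y} ∩ {y : EuclideanSpace ℝ (Fin 3) | ϱ ≤ ‖y‖}) ≤
      ENNReal.ofReal (K * ϱ ^ s))
    {R r : ℝ} (hr : 0 < r) (hrR : r ≤ R) (hfar : ϱ₀ ^ 2 ≤ R * (R - r)) :
    -(3 * γ * (K * (R * (R - r)) ^ (s / 2))) ≤
      ∫ x in {x | h < selfSimilarBernoulli γ 0 V P x}, -(fderiv ℝ (taoCutoff R r) x (selfSimilarTransport γ 0 V x)) := by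
  set S : Set (EuclideanSpace ℝ (Fin 3)) := {x | h < selfSimilarBernoulli γ 0 V P x} with hSdef
  set ϱ : ℝ := Real.sqrt (R * (R - r)) with hϱ
  have hRr : 0 ≤ R * (R - r) := mul_nonneg (hr.le.trans hrR) (sub_nonneg.2 hrR)
  have hϱ₀ϱ : ϱ₀ ≤ ϱ := by
    rw [hϱ, ← Real.sqrt_sq hϱ₀.le]
    exact Real.sqrt_le_sqrt hfar
  have hϱpos : 0 < ϱ := hϱ₀.trans_le hϱ₀ϱ
  -- the far high set is thin, in particular of finite volume
  have hvol : volume (S ∩ {x : EuclideanSpace ℝ (Fin 3) | R * (R - r) ≤ ‖x‖ ^ 2}) ≤ ENNReal.ofReal (K * ϱ ^ s) :=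
    (measure_mono (inter_subset_inter_right _ far_subset_sqrt)).trans (hthin ϱ hϱ₀ϱ)
  have hfin : volume (S ∩ {x : EuclideanSpace ℝ (Fin 3) | R * (R - r) ≤ ‖x‖ ^ 2}) < ⊤ := hvol.trans_lt ENNReal.ofReal_lt_top
  have hturn := highSet_flux_turning_law hγ0 hγ hV6 hG2 hP32 hdiv hH hA h hr hrR hfin
  have hreal : (volume (S ∩ {x : EuclideanSpace ℝ (Fin 3) | R * (R - r) ≤ ‖x‖ ^ 2})).toReal ≤ K * ϱ ^ s :=
    ENNReal.toReal_le_of_le_ofReal (by positivity) hvol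
  have e : ϱ ^ s = (R * (R - r)) ^ (s / 2) := by
    rw [hϱ, Real.sqrt_eq_rpow, ← Real.rpow_mul hRr]
    congr 1; ring
  rw [← e]
  have hγ3 : 0 ≤ 3 * γ := by positivity
  linarith [mul_le_mul_of_nonneg_left hreal hγ3]

end Far

/-! ## Member level -/

section Member

/-- **FAST HIGH SETS OF A PAST-EXACT SELF-SIMILAR CLASS MEMBER ARE THIN FAR OUT, AND THEIR JETS MUST TURN** (`0 < ρ ≤ ½`; NO regularity):
crux hypotheses verbatim, exact self-similarity about `(T, x₀)` for `τ < T₁`; if for some level `h`, rate `a > 0` and radius `R₀` a.e. far point of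
`{ℋ > h}` is fast (`a‖y‖ ≤ ‖V y‖` for `‖y‖ ≥ R₀`), then there are `K ≥ 0` and `ϱ₀ > 0` with
(i) `vol({ℋ > h} ∩ {ϱ ≤ ‖y‖}) ≤ K ϱ^{−3−3ρ}` for `ϱ ≥ ϱ₀`, and (ii) `−3γ·K·(R(R−r))^{(−3−3ρ)/2} ≤ ∫_{ℋ>h} −Dθ_{R,r}[W]` for every layer
`0 < r ≤ R` with `ϱ₀² ≤ R(R−r)`. [folklore] -/
theorem highSet_flux_turning_law_of_fast_of_past {ρ : ℝ} (hρ : 0 < ρ) (hρh : ρ ≤ 1 / 2)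
    {T T₁ : ℝ} (hT₁ : T₁ ≤ 0) (hTT₁ : T₁ ≤ T) (x₀ : EuclideanSpace ℝ (Fin 3))
    {u : ℝ → EuclideanSpace ℝ (Fin 3) → EuclideanSpace ℝ (Fin 3)} {p : ℝ → EuclideanSpace ℝ (Fin 3) → ℝ}
    {H : ℝ → EuclideanSpace ℝ (Fin 3) → EuclideanSpace ℝ (Fin 3) →L[ℝ] EuclideanSpace ℝ (Fin 3)} {c : ℝ≥0}
    (hsw : IsSuitableWeakSolutionOn (slab (EuclideanSpace ℝ (Fin 3)) (Iio 0) isOpen_Iio) 0 0 u p)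
    (hH : HasWeakSpatialGradientOn (slab (EuclideanSpace ℝ (Fin 3)) (Iio 0) isOpen_Iio) u H)
    (hgauge : ∀ a : ℝ, 0 < a →
      ENNReal.ofReal (a ^ (2 * ρ)) * cknA a (0 : ℝ × EuclideanSpace ℝ (Fin 3)) u +
          ENNReal.ofReal (a ^ ρ) * cknE a (0 : ℝ × EuclideanSpace ℝ (Fin 3)) H +
        ENNReal.ofReal (a ^ (2 * ρ)) * cknD a (0 : ℝ × EuclideanSpace ℝ (Fin 3)) p ≤ (c : ℝ≥0∞))
    {V : EuclideanSpace ℝ (Fin 3) → EuclideanSpace ℝ (Fin 3)} {P : EuclideanSpace ℝ (Fin 3) → ℝ}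
    (hu : ∀ τ : ℝ, τ < T₁ → u τ = fun x => selfSimilarCollapse (1 / (2 + ρ)) T V τ (x - x₀))
    (hp : ∀ τ : ℝ, τ < T₁ → p τ = fun x => selfSimilarCollapsePressure (1 / (2 + ρ)) T P τ (x - x₀))
    {h a R₀ : ℝ} (ha : 0 < a)
    (hfast : ∀ᵐ y ∂(volume : Measure (EuclideanSpace ℝ (Fin 3))), R₀ ≤ ‖y‖ →
      h < selfSimilarBernoulli (1 / (2 + ρ)) 0 V P y → a * ‖y‖ ≤ ‖V y‖) :
    ∃ K ϱ₀ : ℝ, 0 ≤ K ∧ 0 < ϱ₀ ∧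
      (∀ ϱ : ℝ, ϱ₀ ≤ ϱ → volume ({y | h < selfSimilarBernoulli (1 / (2 + ρ)) 0 V P y} ∩
        {y : EuclideanSpace ℝ (Fin 3) | ϱ ≤ ‖y‖}) ≤ ENNReal.ofReal (K * ϱ ^ (-3 - 3 * ρ))) ∧
      ∀ R r : ℝ, 0 < r → r ≤ R → ϱ₀ ^ 2 ≤ R * (R - r) →
        -(3 * (1 / (2 + ρ)) * (K * (R * (R - r)) ^ ((-3 - 3 * ρ) / 2))) ≤
          ∫ x in {x | h < selfSimilarBernoulli (1 / (2 + ρ)) 0 V P x},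
            -(fderiv ℝ (taoCutoff R r) x (selfSimilarTransport (1 / (2 + ρ)) 0 V x)) := by
  have hγ0 : 0 ≤ 1 / (2 + ρ) := by positivity
  have hγ : 1 / (2 + ρ) ≤ 1 / 2 := by
    rw [div_le_div_iff₀ (by linarith) (by norm_num)]; linarith
  have hA : ∀ a : ℝ, 0 < a → ENNReal.ofReal (a ^ (2 * ρ)) *
      cknA a (0 : ℝ × EuclideanSpace ℝ (Fin 3)) u ≤ (c : ℝ≥0∞) :=
    fun a ha => le_trans (le_trans le_self_add le_self_add) (hgauge a ha)
  have hE : ∀ a : ℝ, 0 < a → ENNReal.ofReal (a ^ ρ) *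
      cknE a (0 : ℝ × EuclideanSpace ℝ (Fin 3)) H ≤ (c : ℝ≥0∞) :=
    fun a ha => le_trans (le_trans le_add_self le_self_add) (hgauge a ha)
  have hD : ∀ a : ℝ, 0 < a → ENNReal.ofReal (a ^ (2 * ρ)) *
      cknD a (0 : ℝ × EuclideanSpace ℝ (Fin 3)) p ≤ (c : ℝ≥0∞) :=
    fun a ha => le_trans le_add_self (hgauge a ha)
  obtain ⟨G, hVm, hPm, -, hVG, -, ⟨CA, hCA, hAgr⟩, ⟨CE, hCE, hEgr⟩, -, hV6, hG2, hP32, hdiv, heq, -, -⟩ :=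
    Past.profileData_of_past hρ hρh hT₁ hTT₁ x₀ hsw.distributional hH hA hE hD hu hp
  have hHb := WeakBernoulli.hasWeakFDerivOn_bernoulli hV6 hVG hG2
    (WeakPressure.hasWeakFDerivOn_pressure hVm hPm hV6 hVG hG2 hP32 hdiv heq)
  set L₀ : ℝ := max (2 - T₁) 1 with hL₀
  have hL₀1 : 1 ≤ L₀ := le_max_right _ _
  have hAr : ∀ L : ℝ, L₀ ≤ L → ∫⁻ y in ball (0 : EuclideanSpace ℝ (Fin 3)) L, ‖V y‖ₑ ^ 2 ≤
      ENNReal.ofReal (CA.toReal * L ^ (1 - 2 * ρ)) := fun L hL => by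
    rw [ENNReal.ofReal_mul ENNReal.toReal_nonneg, ENNReal.ofReal_toReal hCA]
    exact hAgr L (le_trans (le_max_left _ _) hL)
  have hEr : ∀ L : ℝ, L₀ ≤ L → ∫⁻ y in ball (0 : EuclideanSpace ℝ (Fin 3)) L, ENNReal.ofReal (frobeniusNormSq (G y)) ≤
      ENNReal.ofReal (CE.toReal * L ^ (1 - ρ)) := fun L hL => by
    rw [ENNReal.ofReal_mul ENNReal.toReal_nonneg, ENNReal.ofReal_toReal hCE]
    exact hEgr L (le_trans (le_max_left _ _) hL)
  -- (i) thinness of the far high set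
  obtain ⟨K, hK0, hK⟩ := volume_highSet_inter_far_le_of_fast (ρ := ρ) (by linarith) hVm hVG ENNReal.toReal_nonneg
    ENNReal.toReal_nonneg hL₀1 hAr hEr (Hb := selfSimilarBernoulli (1 / (2 + ρ)) 0 V P) ha hfast
  -- the `A`-growth in the form `∫_{B_L}‖V‖² ≤ c_A L`
  have hA1 : ∀ L : ℝ, L₀ ≤ L → ∫ x in ball (0 : EuclideanSpace ℝ (Fin 3)) L, ‖V x‖ ^ 2 ≤ CA.toReal * L := by
    intro L hL
    have hL1 : 1 ≤ L := le_trans (le_max_right _ _) hL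
    haveI : IsFiniteMeasure ((volume : Measure (EuclideanSpace ℝ (Fin 3))).restrict (ball 0 L)) :=
      isFiniteMeasure_restrict.2 measure_ball_lt_top.ne
    have h2 := setIntegral_norm_sq_le_of_lintegral_le (by positivity) ((hV6 L).mono_exponent (by norm_num)) (hAr L hL)
    refine h2.trans (mul_le_mul_of_nonneg_left ?_ ENNReal.toReal_nonneg)
    calc L ^ (1 - 2 * ρ) ≤ L ^ (1 : ℝ) := Real.rpow_le_rpow_of_exponent_le hL1 (by linarith)
      _ = L := Real.rpow_one L
  set ϱ₀ : ℝ := max L₀ (max R₀ 1) with hϱ₀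
  have hϱ₀pos : 0 < ϱ₀ := lt_of_lt_of_le one_pos ((le_max_right _ _).trans (le_max_right _ _))
  have hthin : ∀ ϱ : ℝ, ϱ₀ ≤ ϱ → volume ({y | h < selfSimilarBernoulli (1 / (2 + ρ)) 0 V P y} ∩
      {y : EuclideanSpace ℝ (Fin 3) | ϱ ≤ ‖y‖}) ≤ ENNReal.ofReal (K * ϱ ^ (-3 - 3 * ρ)) := fun ϱ hϱ =>
    hK ϱ (max_le (le_trans (le_max_left _ _) hϱ) (le_trans ((le_max_left _ _).trans (le_max_right _ _)) hϱ))
  refine ⟨K, ϱ₀, hK0, hϱ₀pos, hthin, fun R r hr hrR hfar => ?_⟩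
  exact highSet_flux_turning_law_of_thin hγ0 hγ hV6 hG2 hP32 hdiv hHb hA1 hK0 hϱ₀pos hthin hr hrR hfar

/-- **FAST HIGH SETS OF AN EXACTLY SELF-SIMILAR CLASS MEMBER: thin far out, and their jets must turn** (origin-centred; binder shape of the
skeleton's `IsExactlySelfSimilar`; `0 < ρ ≤ ½`, NO regularity). [folklore] -/
theorem highSet_flux_turning_law_of_fast_of_selfSimilar {ρ : ℝ} (hρ : 0 < ρ) (hρh : ρ ≤ 1 / 2)
    {u : ℝ → EuclideanSpace ℝ (Fin 3) → EuclideanSpace ℝ (Fin 3)} {p : ℝ → EuclideanSpace ℝ (Fin 3) → ℝ}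
    {H : ℝ → EuclideanSpace ℝ (Fin 3) → EuclideanSpace ℝ (Fin 3) →L[ℝ] EuclideanSpace ℝ (Fin 3)} {c : ℝ≥0}
    (hsw : IsSuitableWeakSolutionOn (slab (EuclideanSpace ℝ (Fin 3)) (Iio 0) isOpen_Iio) 0 0 u p)
    (hH : HasWeakSpatialGradientOn (slab (EuclideanSpace ℝ (Fin 3)) (Iio 0) isOpen_Iio) u H)
    (hgauge : ∀ a : ℝ, 0 < a →
      ENNReal.ofReal (a ^ (2 * ρ)) * cknA a (0 : ℝ × EuclideanSpace ℝ (Fin 3)) u +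
          ENNReal.ofReal (a ^ ρ) * cknE a (0 : ℝ × EuclideanSpace ℝ (Fin 3)) H +
        ENNReal.ofReal (a ^ (2 * ρ)) * cknD a (0 : ℝ × EuclideanSpace ℝ (Fin 3)) p ≤ (c : ℝ≥0∞))
    {V : EuclideanSpace ℝ (Fin 3) → EuclideanSpace ℝ (Fin 3)} {P : EuclideanSpace ℝ (Fin 3) → ℝ}
    (hu : ∀ τ : ℝ, τ < 0 → u τ = selfSimilarCollapse (1 / (2 + ρ)) 0 V τ)
    (hp : ∀ τ : ℝ, τ < 0 → p τ = selfSimilarCollapsePressure (1 / (2 + ρ)) 0 P τ)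
    {h a R₀ : ℝ} (ha : 0 < a)
    (hfast : ∀ᵐ y ∂(volume : Measure (EuclideanSpace ℝ (Fin 3))), R₀ ≤ ‖y‖ →
      h < selfSimilarBernoulli (1 / (2 + ρ)) 0 V P y → a * ‖y‖ ≤ ‖V y‖) :
    ∃ K ϱ₀ : ℝ, 0 ≤ K ∧ 0 < ϱ₀ ∧
      (∀ ϱ : ℝ, ϱ₀ ≤ ϱ → volume ({y | h < selfSimilarBernoulli (1 / (2 + ρ)) 0 V P y} ∩
        {y : EuclideanSpace ℝ (Fin 3) | ϱ ≤ ‖y‖}) ≤ ENNReal.ofReal (K * ϱ ^ (-3 - 3 * ρ))) ∧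
      ∀ R r : ℝ, 0 < r → r ≤ R → ϱ₀ ^ 2 ≤ R * (R - r) →
        -(3 * (1 / (2 + ρ)) * (K * (R * (R - r)) ^ ((-3 - 3 * ρ) / 2))) ≤
          ∫ x in {x | h < selfSimilarBernoulli (1 / (2 + ρ)) 0 V P x},
            -(fderiv ℝ (taoCutoff R r) x (selfSimilarTransport (1 / (2 + ρ)) 0 V x)) := by
  have hu' : ∀ τ : ℝ, τ < 0 → u τ = fun x => selfSimilarCollapse (1 / (2 + ρ)) 0 V τ (x - 0) :=
    fun τ hτ => by rw [hu τ hτ]; funext x; rw [sub_zero]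
  have hp' : ∀ τ : ℝ, τ < 0 → p τ = fun x => selfSimilarCollapsePressure (1 / (2 + ρ)) 0 P τ (x - 0) :=
    fun τ hτ => by rw [hp τ hτ]; funext x; rw [sub_zero]
  exact highSet_flux_turning_law_of_fast_of_past hρ hρh le_rfl le_rfl 0 hsw hH hgauge hu' hp' ha hfast

end Member

end WeakRenormalized

end Summit.NavierStokesRegularity.NavierStokesRegularity.Theorems.PowerGaugeEulerLiouville
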